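import Summits.Ventures.CertifiedManyBodySolver.Rows.CorrWindowBoxAffineCloser
import HarnessLib

/-!
# The CHAIN FOREST: P independent sub-chains over CONSECUTIVE segments of the slice list, each from the EMPTY accumulator, and ONE merge
# — the gate verifies a certificate P-wide; kernel-hours, bytes and every data module unchanged; ZERO carriers

HONEST FRAMING: Lean plumbing towards «tier P» (cell hubbard-obs; captain cov-la214-plan-1 g4 RULING R-g4-11 «(L6) GO-TYPE NOW, ready-by 05:45Z»;
design by hubbard-cov-la214-sdp-1 g5 02:24:15Z, sized by obs-p2 02:24:46Z). WHY SOUND: (i) a hinted step depends only on its slice and hint list, never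
on the accumulator it is merged into (`evalPoly_stepEQA`, p677450); (ii) `mergeE` denotes the SUM (`evalPoly_decPoly_mergeE'`, p672734). So for
segments `[a_p, a_p + m_p)` tiling `[0, |Ts|)`: each segment's chain from `[]` denotes `Σ_{s ∈ segment} termOp Ts[s] − symTL(moves_p) − ahT(adj_p)`,
and the merge of the P ends denotes `termOp Ts.flatten − symTL(moves₁ ++ … ++ moves_P) − ahT(adj₁ ++ …)` — exactly the residual hypothesis the
closers of record consume. OBJECTS: (§1) offset steps `StepOff D B a Cs Ts Hs k` (segment-local accumulators `Cs`, GLOBAL slice/hint indices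
`a + k` — the shape the emitted step facts `C_p_{k+1} = stepEQA D B C_p_k (slices.getD s []) (… HC_s)` already have), ranges `StepsOff … k₁ k₂`
(`nil/cons/snoc/append/single`), the segment invariant `evalPoly_stepsOff`; (§2) `mergeAllE B : List EncPoly → EncPoly` and `evalPoly_mergeAllE`;
(§3) `Seg` (step count + accumulators), `ForestFrom D B Ts Hs a segs` (each segment from `[]`, consecutive, ending at `Ts.length`), `ends`,
`forestMoves`/`forestAdj`, **`evalPoly_forest`**; (§4) closers `affineOrbitLowerRowN_of_quotAdjForestKernelCertGXAuto` (abstract Gram with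
anti-Hermitian remainder, kernel eom masks; hypotheses of `…GXAuto` with `ns M Cs hC0 Hs hchain hq` replaced by `ns Hs segs hforest Cfin hfin hq`) and
the single-vertex box twin **`affineOrbitLowerRowN_of_forestTBRowsHalfAuto_box`** (every geometry binder discharged, as p686809). Nothing of record;
no certificate evaluated; CONTROL/CALIBRATION context (wording (xx1)); silent on the presence of superconductivity; not a `T_c` or phase sentence;
nothing about any material; no summit statement is proved by this file. Seat hubbard-obs-p2 (STIFFNESS), `prover-hubbard-obs-p2-g24-0`, zero compute.

References: C. Jansson, D. Chaykin, C. Keil, SIAM J. Numer. Anal. 46 (2008) 180 (staged rigorous replay) [JanssonChaykinKeil2008]; X. Han,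
arXiv:2006.06002 §3 [Han2020Bootstrap]; J. Wang et al., PRX 14 (2024) 031006 §III [WangEtAl2024].
-/

namespace Summit.Ventures.CertifiedManyBodySolver

namespace CARPolyWindow

open Summit.Ventures.CertifiedQuantumChemistry Summit.Ventures.CertifiedQuantumChemistry.CARPoly
open Literature.MathematicalPhysics.QuantumLattice Literature.MathematicalPhysics.QuantumLattice.HubbardWave0
open Literature.MathematicalPhysics.QuantumManyBody.StateRelaxation
open Literature.Probability.LatticeModels ThermodynamicLimit Filter Topology
open Matrix BoxGeom
open scoped ComplexOrder BigOperators

/-! ## §1 Offset steps and segment ranges -/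

section Segments

variable {N Nβ : ℕ}

/-- **Step `k` of a SEGMENT starting at global slice index `a`**: the segment-local accumulator `k+1` IS the step of accumulator `k` with the
GLOBAL slice and hint list `a + k`. [cite: JanssonChaykinKeil2008, §3] -/
def StepOff (D : QuotData N Nβ) (B a : ℕ) (Cs : List SOSDual.EncPoly) (Ts : List (Terms (Orb (Fin N)))) (Hs : List (List (QHint Nβ)))
    (k : ℕ) : Prop :=
  Cs.getD (k + 1) [] = stepEQA D B (Cs.getD k []) (Ts.getD (a + k) []) (Hs.getD (a + k) [])

/-- The segment steps `k₁ ≤ k < k₂` hold. [folklore] -/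
def StepsOff (D : QuotData N Nβ) (B a : ℕ) (Cs : List SOSDual.EncPoly) (Ts : List (Terms (Orb (Fin N)))) (Hs : List (List (QHint Nβ)))
    (k₁ k₂ : ℕ) : Prop :=
  ∀ k, k₁ ≤ k → k < k₂ → StepOff D B a Cs Ts Hs k

variable {D : QuotData N Nβ} {B a : ℕ} {Cs : List SOSDual.EncPoly} {Ts : List (Terms (Orb (Fin N)))} {Hs : List (List (QHint Nβ))}

/-- The empty range. [folklore] -/
theorem StepsOff.nil (k : ℕ) : StepsOff D B a Cs Ts Hs k k := fun _ h₁ h₂ => absurd (lt_of_le_of_lt h₁ h₂) (lt_irrefl _)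

/-- One step in front of a range. [folklore] -/
theorem StepsOff.cons {k₁ k₂ : ℕ} (h : StepOff D B a Cs Ts Hs k₁) (hs : StepsOff D B a Cs Ts Hs (k₁ + 1) k₂) : StepsOff D B a Cs Ts Hs k₁ k₂ := by
  intro k h₁ h₂
  rcases Nat.eq_or_lt_of_le h₁ with rfl | hlt
  · exact h
  · exact hs k hlt h₂

/-- One step behind a range. [folklore] -/
theorem StepsOff.snoc {k₁ k₂ : ℕ} (hs : StepsOff D B a Cs Ts Hs k₁ k₂) (h : StepOff D B a Cs Ts Hs k₂) : StepsOff D B a Cs Ts Hs k₁ (k₂ + 1) := by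
  intro k h₁ h₂
  rcases Nat.lt_succ_iff_lt_or_eq.1 h₂ with hlt | rfl
  · exact hs k h₁ hlt
  · exact h

/-- Two adjacent ranges. [folklore] -/
theorem StepsOff.append {k₁ k₂ k₃ : ℕ} (h₁ : StepsOff D B a Cs Ts Hs k₁ k₂) (h₂ : StepsOff D B a Cs Ts Hs k₂ k₃) : StepsOff D B a Cs Ts Hs k₁ k₃ := by
  intro k hk₁ hk₃
  rcases Nat.lt_or_ge k k₂ with hk | hk
  · exact h₁ k hk₁ hk
  · exact h₂ k hk hk₃

/-- A single step as a range. [folklore] -/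
theorem StepsOff.single {k : ℕ} (h : StepOff D B a Cs Ts Hs k) : StepsOff D B a Cs Ts Hs k (k + 1) := StepsOff.cons h (StepsOff.nil _)

/-- The slices a segment consumes in its first `n` steps, as one term list. [folklore] -/
def segTerms (a : ℕ) (Ts : List (Terms (Orb (Fin N)))) : ℕ → Terms (Orb (Fin N))
  | 0 => []
  | n + 1 => segTerms a Ts n ++ Ts.getD (a + n) []

/-- The accepted moves of a segment's first `n` steps. [cite: Han2020Bootstrap, §3] -/
def segMoves (D : QuotData N Nβ) (B a : ℕ) (Ts : List (Terms (Orb (Fin N)))) (Hs : List (List (QHint Nβ))) :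
    ℕ → List (Fin 8 × (ℤ × ℤ) × Terms (Orb (Fin Nβ)))
  | 0 => []
  | n + 1 => segMoves D B a Ts Hs n ++ movesOfZ D B (Ts.getD (a + n) []) (Hs.getD (a + n) [])

/-- The adjoint generators recorded by a segment's first `n` steps. [folklore] -/
def segAdj (D : QuotData N Nβ) (B a : ℕ) (Ts : List (Terms (Orb (Fin N)))) (Hs : List (List (QHint Nβ))) : ℕ → List (Terms (Orb (Fin N)))
  | 0 => []
  | n + 1 => segAdj D B a Ts Hs n ++ adjOf D B (Ts.getD (a + n) []) (Hs.getD (a + n) [])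

/-- Every move a segment accepts is licensed (the hints are re-checked by `rowOK`). [folklore] -/
theorem ok_of_mem_segMoves (D : QuotData N Nβ) (B a : ℕ) (Ts : List (Terms (Orb (Fin N)))) (Hs : List (List (QHint Nβ))) :
    ∀ n, ∀ mv ∈ segMoves D B a Ts Hs n, D.ok mv.1 mv.2.1 = true
  | 0, mv, hmv => absurd hmv List.not_mem_nil
  | n + 1, mv, hmv => by
    rw [segMoves, List.mem_append] at hmv
    rcases hmv with hmv | hmv
    · exact ok_of_mem_segMoves D B a Ts Hs n mv hmv
    · rw [movesOfZ, quotMovesZ, List.mem_filterMap] at hmv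
      obtain ⟨x, hx, hmap⟩ := hmv
      obtain ⟨e, hxe, hFe⟩ := Option.map_eq_some_iff.1 hmap
      obtain ⟨hok, -, -⟩ := annotate_ok D B _ _ x hx e hxe
      rw [← hFe]
      exact hok

variable [NeZero N] {ι : Type*} [LinearOrder ι] [Fintype ι]

/-- **The segment invariant**: after `n` steps from the EMPTY accumulator, the local accumulator denotes the consumed slices minus the
segment's moves and adjoint generators. [cite: JanssonChaykinKeil2008, §3] [cite: Han2020Bootstrap, §3] -/
theorem evalPoly_stepsOff {d : Orb (Fin N) → ι} (hd : Function.Injective d) {m : ℕ} (hC0 : Cs.getD 0 [] = [])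
    (h : StepsOff D B a Cs Ts Hs 0 m) :
    ∀ n, n ≤ m → evalPoly d (SOSDual.decPoly N (Cs.getD n [])) =
      termOp d (segTerms a Ts n) - termOp d (symTL D.f (gq D) (segMoves D B a Ts Hs n)) - termOp d (ahT (segAdj D B a Ts Hs n))
  | 0, _ => by
    rw [hC0, evalPoly_decPoly_nil, segTerms, termOp_nil, segMoves, symTL_nil, termOp_nil, segAdj, ahT_nil, termOp_nil]
    simp
  | n + 1, hn => by
    have ih := evalPoly_stepsOff hd hC0 h n (Nat.le_of_succ_le hn)
    have hs : StepOff D B a Cs Ts Hs n := h n (Nat.zero_le _) hn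
    rw [StepOff] at hs
    rw [hs, evalPoly_stepEQA hd, ih, segTerms, termOp_append, segMoves, symTL_append, termOp_append, segAdj, ahT_append, termOp_append]
    abel

end Segments

/-! ## §2 Merging the segment ends -/

section Merge

variable {N : ℕ}

/-- **Merge a list of encoded accumulators** (right fold of the engine's `mergeE`). [cite: JanssonChaykinKeil2008, §3] -/
def mergeAllE (B : ℕ) : List SOSDual.EncPoly → SOSDual.EncPoly
  | [] => []
  | C :: Cs => SOSDual.mergeE B C (mergeAllE B Cs)

variable [NeZero N] {ι : Type*} [LinearOrder ι] [Fintype ι]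

/-- **The merge denotes the SUM.** [folklore] -/
theorem evalPoly_mergeAllE (d : Orb (Fin N) → ι) (B : ℕ) :
    ∀ Cs : List SOSDual.EncPoly, evalPoly d (SOSDual.decPoly N (mergeAllE B Cs)) = (Cs.map fun C => evalPoly d (SOSDual.decPoly N C)).sum
  | [] => by rw [mergeAllE, evalPoly_decPoly_nil, List.map_nil, List.sum_nil]
  | C :: Cs => by rw [mergeAllE, evalPoly_decPoly_mergeE', evalPoly_mergeAllE d B Cs, List.map_cons, List.sum_cons]

end Merge

/-! ## §3 The forest -/

section Forest

variable {N Nβ : ℕ}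

/-- One segment of a forest: its step count and its accumulators (`Cs.getD 0 [] = []`, `Cs.getD m []` = its end). [folklore] -/
structure Seg where
  /-- number of steps -/
  m : ℕ
  /-- segment-local accumulators, from the empty one -/
  Cs : List SOSDual.EncPoly

/-- **The forest record from global index `a`**: each segment starts from `[]`, proves its `m` offset steps, and the next segment starts
where it ends; after the last segment `a = Ts.length`. [cite: JanssonChaykinKeil2008, §3] -/
def ForestFrom (D : QuotData N Nβ) (B : ℕ) (Ts : List (Terms (Orb (Fin N)))) (Hs : List (List (QHint Nβ))) : ℕ → List Seg → Prop
  | a, [] => a = Ts.length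
  | a, sg :: rest => sg.Cs.getD 0 [] = [] ∧ StepsOff D B a sg.Cs Ts Hs 0 sg.m ∧ ForestFrom D B Ts Hs (a + sg.m) rest

/-- Constructor: the empty forest at the end of the slice list (instance: `forestFrom_nil (by decide +kernel)`). [folklore] -/
theorem forestFrom_nil {D : QuotData N Nβ} {B : ℕ} {Ts : List (Terms (Orb (Fin N)))} {Hs : List (List (QHint Nβ))} {a : ℕ}
    (h : a = Ts.length) : ForestFrom D B Ts Hs a [] := h

/-- Constructor: one more segment in front (instance: `forestFrom_cons rfl steps_p rest`). [folklore] -/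
theorem forestFrom_cons {D : QuotData N Nβ} {B : ℕ} {Ts : List (Terms (Orb (Fin N)))} {Hs : List (List (QHint Nβ))} {a : ℕ} {sg : Seg}
    {rest : List Seg} (h0 : sg.Cs.getD 0 [] = []) (hs : StepsOff D B a sg.Cs Ts Hs 0 sg.m) (hr : ForestFrom D B Ts Hs (a + sg.m) rest) :
    ForestFrom D B Ts Hs a (sg :: rest) := ⟨h0, hs, hr⟩

/-- The ends of the segments (what the ONE merge declaration merges). [folklore] -/
def ends (segs : List Seg) : List SOSDual.EncPoly := segs.map fun sg => sg.Cs.getD sg.m []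

/-- All accepted moves of a forest from index `a`. [cite: Han2020Bootstrap, §3] -/
def forestMoves (D : QuotData N Nβ) (B : ℕ) (Ts : List (Terms (Orb (Fin N)))) (Hs : List (List (QHint Nβ))) :
    ℕ → List Seg → List (Fin 8 × (ℤ × ℤ) × Terms (Orb (Fin Nβ)))
  | _, [] => []
  | a, sg :: rest => segMoves D B a Ts Hs sg.m ++ forestMoves D B Ts Hs (a + sg.m) rest

/-- All recorded adjoint generators of a forest from index `a`. [folklore] -/
def forestAdj (D : QuotData N Nβ) (B : ℕ) (Ts : List (Terms (Orb (Fin N)))) (Hs : List (List (QHint Nβ))) : ℕ → List Seg → List (Terms (Orb (Fin N)))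
  | _, [] => []
  | a, sg :: rest => segAdj D B a Ts Hs sg.m ++ forestAdj D B Ts Hs (a + sg.m) rest

/-- Every move of a forest is licensed. [folklore] -/
theorem ok_of_mem_forestMoves (D : QuotData N Nβ) (B : ℕ) (Ts : List (Terms (Orb (Fin N)))) (Hs : List (List (QHint Nβ))) :
    ∀ (segs : List Seg) (a : ℕ), ∀ mv ∈ forestMoves D B Ts Hs a segs, D.ok mv.1 mv.2.1 = true
  | [], _, mv, hmv => absurd hmv List.not_mem_nil
  | sg :: rest, a, mv, hmv => by
    rw [forestMoves, List.mem_append] at hmv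
    rcases hmv with hmv | hmv
    · exact ok_of_mem_segMoves D B a Ts Hs sg.m mv hmv
    · exact ok_of_mem_forestMoves D B Ts Hs rest (a + sg.m) mv hmv

variable {ι : Type*} [LinearOrder ι] [Fintype ι]

/-- The consumed slices of a segment inside the list are a `take` of a `drop`. [folklore] -/
theorem termOp_segTerms (d : Orb (Fin N) → ι) (a : ℕ) (Ts : List (Terms (Orb (Fin N)))) :
    ∀ n, a + n ≤ Ts.length → termOp d (segTerms a Ts n) = termOp d ((Ts.drop a).take n).flatten
  | 0, _ => by rw [segTerms, List.take_zero, List.flatten_nil]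
  | n + 1, hn => by
    have hlt : n < (Ts.drop a).length := by rw [List.length_drop]; omega
    rw [segTerms, termOp_append, termOp_segTerms d a Ts n (by omega), List.take_succ_eq_append_getElem hlt, List.flatten_append,
      List.flatten_singleton, termOp_append, List.getElem_drop, List.getD_eq_getElem _ _ (by omega)]

variable [NeZero N]

/-- **THE FOREST THEOREM**: the sum of what the segment ends denote = all slices from index `a` minus all moves minus all adjoint generators.
[cite: JanssonChaykinKeil2008, §3] [cite: Han2020Bootstrap, §3] -/
theorem evalPoly_forest {d : Orb (Fin N) → ι} (hd : Function.Injective d) (D : QuotData N Nβ) (B : ℕ) (Ts : List (Terms (Orb (Fin N))))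
    (Hs : List (List (QHint Nβ))) :
    ∀ (segs : List Seg) (a : ℕ), ForestFrom D B Ts Hs a segs →
      ((ends segs).map fun C => evalPoly d (SOSDual.decPoly N C)).sum =
        termOp d (Ts.drop a).flatten - termOp d (symTL D.f (gq D) (forestMoves D B Ts Hs a segs)) - termOp d (ahT (forestAdj D B Ts Hs a segs))
  | [], a, h => by
    rw [ForestFrom] at h
    rw [ends, List.map_nil, List.map_nil, List.sum_nil, forestMoves, symTL_nil, termOp_nil, forestAdj, ahT_nil, termOp_nil, h,
      List.drop_length, List.flatten_nil, termOp_nil]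
    simp
  | sg :: rest, a, h => by
    rw [ForestFrom] at h
    obtain ⟨hC0, hsteps, hrest⟩ := h
    have ih := evalPoly_forest hd D B Ts Hs rest (a + sg.m) hrest
    -- the end of a forest is `Ts.length`, so this segment fits
    have hfit : ∀ (segs : List Seg) (b : ℕ), ForestFrom D B Ts Hs b segs → b ≤ Ts.length := by
      intro segs
      induction segs with
      | nil => intro b hb; rw [ForestFrom] at hb; exact hb.le
      | cons sg' rest' ihs => intro b hb; rw [ForestFrom] at hb; exact le_trans (Nat.le_add_right _ _) (ihs (b + sg'.m) hb.2.2)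
    have hle : a + sg.m ≤ Ts.length := hfit rest (a + sg.m) hrest
    have hseg := evalPoly_stepsOff hd hC0 hsteps sg.m le_rfl
    rw [ends, List.map_cons, List.map_cons, List.sum_cons, ← ends, ih, hseg, termOp_segTerms d a Ts sg.m hle, forestMoves, symTL_append,
      termOp_append, forestAdj, ahT_append, termOp_append]
    have hsplit : termOp d (Ts.drop a).flatten = termOp d ((Ts.drop a).take sg.m).flatten + termOp d (Ts.drop (a + sg.m)).flatten := by
      rw [← termOp_append, ← List.flatten_append, ← List.drop_drop, List.take_append_drop]
    rw [hsplit]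
    abel

end Forest

/-! ## §4 The closers -/

noncomputable section ForestClosers

variable {N Nβ : ℕ} [NeZero N]

/-- **CLOSER, CHAIN FOREST, ABSTRACT GRAM WITH ANTI-HERMITIAN REMAINDER, KERNEL EOM MASKS**: as
`affineOrbitLowerRowN_of_quotAdjChainKernelCertGXAuto` with the serial chain (`ns M Cs hC0 Hs hchain hq`) replaced by a FOREST:
`ns` (regrouping), the global hint list `Hs`, the segments `segs`, `hforest : ForestFrom D Bkey slices Hs 0 segs`, the merged end `Cfin` with its kernel
fact `hfin : Cfin = mergeAllE Bkey (ends segs)`, and the ONE inequality on `Cfin`. [cite: WangEtAl2024, §III] [cite: Han2020Bootstrap, §3]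
[cite: JanssonChaykinKeil2008, §3] -/
theorem affineOrbitLowerRowN_of_quotAdjForestKernelCertGXAuto
    (tp U : ℚ) (hU : 0 ≤ U)
    {Λ Λ' : Finset (Site 2)} (hΛ : Λ ⊆ Λ') (h8 : thicken Λ 1 ⊆ Λ')
    (h0 : thicken ({0} : Finset (Site 2)) 1 ⊆ Λ') (hz : (0 : Site 2) ∈ Λ')
    {S : Finset (DihedralGroup 4)} (h1 : (1 : DihedralGroup 4) ∈ S) (hmul : ∀ a ∈ S, ∀ b ∈ S, a * b ∈ S)
    (D : QuotData N Nβ) (hxs : ∀ i, D.xs i ∈ Λ') (hix : ∀ y ∈ Λ', D.xs (D.ix y) = y)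
    (hxsβ : ∀ j, D.xsβ j ∈ Λ) (hcovβ : ∀ x ∈ Λ, ∃ j, D.xsβ j = x)
    (d : Orb (Fin N) → Orb (PolySite Λ')) (hd : Function.Injective d)
    (hdx : ∀ i σ, d (orb i σ) = orb (PolySite.pt (D.xs i) (hxs i)) σ) (Bkey : ℕ)
    (dΛ : Orb (Fin Nβ) → Orb (PolySite Λ)) (hdΛ : ∀ j σ, dΛ (orb j σ) = orb (PolySite.pt (D.xsβ j) (hxsβ j)) σ)
    (hf : ∀ b, d (D.f b) = Orb.embMap (PolySite.incl hΛ) (dΛ b))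
    (sp : Orb (Fin N) → Fin 2) (hsp : ∀ a, (ofLex (d a)).2 = sp a)
    (hokS : ∀ γc v, D.ok γc v = true → d4OfCode γc ∈ S)
    (hokV : ∀ γc v, D.ok γc v = true →
      ∀ j : Fin Nβ, D.xs (D.ix (d4Vec (d4OfCode γc) (D.xsβ j) + siteOfPair v)) = d4Vec (d4OfCode γc) (D.xsβ j) + siteOfPair v)
    (TH : Terms (Orb (Fin N))) (hH : termOp d TH = (hubbardTTPrimeFermionInteraction 1 tp U).localHamiltonian Λ')
    (TE : Terms (Orb (Fin N)))
    (hE : termOp d TE = fermionEmbed (PolySite.incl h0) ((hubbardTTPrimeFermionInteraction 1 tp U).meanEnergyObs 1))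
    (o : Fin 2 → Orb (Fin N)) (ho : ∀ σ, d (o σ) = orb (PolySite.pt 0 hz) σ)
    (TX : Terms (Orb (Fin N))) (μ : Fin 2 → ℚ) (ν κhi hi κlo lo : ℚ)
    (TGs : List (Terms (Orb (Fin N)))) (TGf V : Terms (Orb (Fin N)))
    {m : Type*} [Fintype m] [DecidableEq m] {Λm : Matrix m m ℂ} (hΛm : Λm.PosSemidef)
    (O : m → FermionOp Λ') (hTGf : termOp d TGf = gramForm Λm O)
    (hX : termOp d TGs.flatten = termOp d TGf - termOp d V + (termOp d V)ᴴ)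
    (EB : List (Terms (Orb (Fin Nβ))))
    (CW : Terms (Orb (Fin N))) (hcw : ∀ wc ∈ CW, chargeW wc.1 ≠ 0 ∨ spinChargeW sp wc.1 ≠ 0)
    (AV : List (Terms (Orb (Fin N))))
    -- the forest
    (ns : List ℕ) (Hs : List (List (QHint Nβ))) (segs : List Seg)
    (hforest : ForestFrom D Bkey
      (groupSlices (residTGslicesNear TX μ ν o κhi hi κlo lo TE TGs TH D.f EB (autoMasks TH D.f EB)
        (fun l : Fin 0 => l.elim0) (fun l : Fin 0 => l.elim0) CW AV) ns) Hs 0 segs)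
    (Cfin : SOSDual.EncPoly) (hfin : Cfin = mergeAllE Bkey (ends segs))
    {q s n₀ : ℚ} (hs : s = (μ 0 + μ 1) / 2)
    (hq : q ≤ lowerConst (SOSDual.decPoly N Cfin) + (μ 0 + μ 1) * (n₀ / 2 - ν)) :
    SquareTTPrimeCorrAffineOrbitLowerRowN (tp : ℝ) (U : ℝ) q hi lo κhi κlo s n₀ S Λ' (termOp d TX) := by
  set Ts := groupSlices (residTGslicesNear TX μ ν o κhi hi κlo lo TE TGs TH D.f EB (autoMasks TH D.f EB)
    (fun l : Fin 0 => l.elim0) (fun l : Fin 0 => l.elim0) CW AV) ns with hTs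
  set L := forestMoves D Bkey Ts Hs 0 segs with hL
  set LA := forestAdj D Bkey Ts Hs 0 segs with hLA
  have hLok : ∀ mv ∈ L, D.ok mv.1 mv.2.1 = true := ok_of_mem_forestMoves D Bkey Ts Hs segs 0
  let γf : Fin L.length → DihedralGroup 4 := fun l => d4OfCode (L.get l).1
  let wvf : Fin L.length → Site 2 := fun l => siteOfPair (L.get l).2.1
  let gf : Fin L.length → Orb (Fin Nβ) → Orb (Fin N) := fun l => gq D (γf l) (wvf l)
  let SYf : Fin L.length → Terms (Orb (Fin Nβ)) := fun l => (L.get l).2.2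
  have hγS : ∀ l, γf l ∈ S := fun l => hokS _ _ (hLok _ (List.get_mem L l))
  have hsh : ∀ l, d4ShiftSet (γf l) (wvf l) Λ ⊆ Λ' := fun l =>
    shiftSet_subset_of_table D hxs hcovβ (γf l) (wvf l) (hokV _ _ (hLok _ (List.get_mem L l)))
  have hg : ∀ l b, d (gf l b) = Orb.embMap (PolySite.incl (hsh l)) (Orb.embMap (PolySite.d4Emb (γf l) (wvf l) Λ) (dΛ b)) :=
    fun l b => by rw [← orb_ofLex_eq b]; exact d_gq D hxs d hdx hix hxsβ dΛ hdΛ (γf l) (wvf l) (hsh l) _ _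
  -- the semantic residual hypothesis from the forest
  have hRsem : evalPoly d (SOSDual.decPoly N Cfin) =
      termOp d (residTG TX μ ν o κhi hi κlo lo TE TGs.flatten TH D.f EB gf SYf CW (AV ++ LA)) := by
    rw [hfin, evalPoly_mergeAllE, evalPoly_forest hd D Bkey Ts Hs segs 0 hforest, List.drop_zero, hTs, flatten_groupSlices,
      termOp_flatten_residTGslicesNear_auto hd TX μ ν o κhi hi κlo lo TE _ TH D.f EB _ _ CW AV,
      termOp_residTG_moves_adj d TX μ ν o κhi hi κlo lo TE _ TH D.f EB gf SYf CW AV LA, ← hTs, ← hL, ← hLA, termOp_symTL_eq]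
  rw [termOp_residTG_gramX d TX μ ν o κhi hi κlo lo TE TGs.flatten TGf V hX TH D.f EB gf SYf CW (AV ++ LA)] at hRsem
  exact affineOrbitLowerRowN_of_residPolyG tp U hU hΛ h8 h0 hz h1 hmul d dΛ D.f hf sp hsp TH hH TE hE o ho TX μ ν κhi hi κlo lo
    TGf hΛm O hTGf EB γf hγS wvf hsh gf hg SYf CW hcw ((AV ++ LA) ++ [V]) hRsem hs hq

/-- **CLOSER, CHAIN FOREST, SINGLE VERTEX AT BOX GEOMETRY, HALF-ROW GRAM** (the forest twin of
`affineOrbitLowerRowN_of_chainTBRowsHalfAuto_box`): instance constants `D TH TE o` with `rfl` equations, data, the forest record, the merged end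
and ONE inequality. [cite: WangEtAl2024, §III] [cite: Han2020Bootstrap, §3] [cite: JanssonChaykinKeil2008, §3] -/
theorem affineOrbitLowerRowN_of_forestTBRowsHalfAuto_box (r R vmax : ℕ) (hrR : r + 1 ≤ R) (hv : r + vmax ≤ R)
    (tp U : ℚ) (hU : 0 ≤ U) (Bkey : ℕ)
    (D : QuotData (boxN R) (boxN r)) (hD : D = boxQuot r R vmax)
    (TH : Terms (Orb (Fin (boxN R)))) (hTH : TH = hamTermsBox R 1 tp U)
    (TE : Terms (Orb (Fin (boxN R)))) (hTE : TE = energyTermsIdx 1 tp U (boxIx R))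
    (o : Fin 2 → Orb (Fin (boxN R))) (ho : o = fun σ => orb (boxIx R 0) σ)
    (TX : Terms (Orb (Fin (boxN R)))) (μ : Fin 2 → ℚ) (ν κhi hi κlo lo : ℚ) (K : ℕ)
    (blocks : List (List (List ℤ × Terms (Orb (Fin (boxN R)))))) (EB : List (Terms (Orb (Fin (boxN r)))))
    (CW : Terms (Orb (Fin (boxN R)))) (hcw : ∀ wc ∈ CW, chargeW wc.1 ≠ 0 ∨ spinChargeW (fun p => (ofLex p).2) wc.1 ≠ 0)
    (AV : List (Terms (Orb (Fin (boxN R)))))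
    (ns : List ℕ) (Hs : List (List (QHint (boxN r)))) (segs : List Seg)
    (hforest : ForestFrom D Bkey
      (groupSlices (residTGslicesNear TX μ ν o κhi hi κlo lo TE (gramTBRowsHalf K blocks) TH D.f EB (autoMasks TH D.f EB)
        (fun l : Fin 0 => l.elim0) (fun l : Fin 0 => l.elim0) CW AV) ns) Hs 0 segs)
    (Cfin : SOSDual.EncPoly) (hfin : Cfin = mergeAllE Bkey (ends segs))
    {q s n₀ : ℚ} (hs : s = (μ 0 + μ 1) / 2)
    (hq : haveI := neZero_boxN R; q ≤ lowerConst (SOSDual.decPoly (boxN R) Cfin) + (μ 0 + μ 1) * (n₀ / 2 - ν)) :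
    SquareTTPrimeCorrAffineOrbitLowerRowN (tp : ℝ) (U : ℝ) q hi lo κhi κlo s n₀ Finset.univ (boxW R) (termOp (boxD R) TX) := by
  haveI : NeZero (boxN R) := neZero_boxN R
  subst hD hTH hTE ho
  have hR : 1 ≤ R := le_trans (Nat.le_add_left 1 r) hrR
  have hrle : r ≤ R := le_trans (Nat.le_succ r) hrR
  have hz : (0 : Site 2) ∈ boxW R := zero_mem_boxW R
  have h1 : (1 : DihedralGroup 4) ∈ (Finset.univ : Finset (DihedralGroup 4)) := Finset.mem_univ _
  have hmul : ∀ a ∈ (Finset.univ : Finset (DihedralGroup 4)), ∀ b ∈ (Finset.univ : Finset (DihedralGroup 4)),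
      a * b ∈ (Finset.univ : Finset (DihedralGroup 4)) := fun _ _ _ _ => Finset.mem_univ _
  have hΛ : boxW r ⊆ boxW R := boxW_mono hrle
  have h8 : thicken (boxW r) 1 ⊆ boxW R := Summit.Ventures.CertifiedManyBodySolver.Downfold.thicken_boxW_subset_boxW hrR
  have h0 : thicken ({0} : Finset (Site 2)) 1 ⊆ boxW R := Summit.Ventures.CertifiedManyBodySolver.Downfold.thicken01_subset_boxW hR
  have ho' : ∀ σ : Fin 2, boxD R ((fun σ => orb (boxIx R 0) σ) σ) = orb (PolySite.pt 0 hz) σ := fun σ =>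
    Summit.Ventures.CertifiedManyBodySolver.Downfold.boxD_orb_boxIx_zero R σ
  have hix0 : ∀ v ∈ thicken ({0} : Finset (Site 2)) 1, boxXs R (boxIx R v) = v := fun v hv => boxXs_boxIx R v (h0 hv)
  have hokS : ∀ (γc : Fin 8) (v : ℤ × ℤ), (boxQuot r R vmax).ok γc v = true → d4OfCode γc ∈ (Finset.univ : Finset (DihedralGroup 4)) :=
    fun _ _ _ => Finset.mem_univ _
  have hokV : ∀ (γc : Fin 8) (v : ℤ × ℤ), (boxQuot r R vmax).ok γc v = true → ∀ j : Fin (boxN r),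
      (boxQuot r R vmax).xs ((boxQuot r R vmax).ix (d4Vec (d4OfCode γc) ((boxQuot r R vmax).xsβ j) + siteOfPair v)) =
        d4Vec (d4OfCode γc) ((boxQuot r R vmax).xsβ j) + siteOfPair v :=
    fun γc v h j => box_hokV hv γc v h j
  have hH : termOp (boxD R) (hamTermsBox R 1 tp U) = (hubbardTTPrimeFermionInteraction 1 (tp : ℝ) (U : ℝ)).localHamiltonian (boxW R) := by
    rw [termOp_hamTermsBox, Rat.cast_one]
  have hE : termOp (boxD R) (energyTermsIdx 1 tp U (boxIx R)) =
      fermionEmbed (PolySite.incl h0) ((hubbardTTPrimeFermionInteraction 1 (tp : ℝ) (U : ℝ)).meanEnergyObs 1) := by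
    have h := termOp_energyTermsIdx (N := boxN R) 1 tp U (boxXs R) (boxXs_mem R) h0 (boxIx R) hix0 (boxD R) (boxD_orb R)
    rw [Rat.cast_one] at h
    exact h
  exact affineOrbitLowerRowN_of_quotAdjForestKernelCertGXAuto tp U hU hΛ h8 h0 hz h1 hmul (boxQuot r R vmax) (boxXs_mem R)
    (boxXs_boxIx R) (boxXs_mem r) (boxQuot_hcovβ r R vmax) (boxD R) (boxD_injective R) (boxD_orb R) Bkey (boxD r) (boxQuot_hdΛ r R vmax)
    (boxD_boxPush hrle) (fun p => (ofLex p).2) (boxD_spin R) hokS hokV (hamTermsBox R 1 tp U) hH (energyTermsIdx 1 tp U (boxIx R)) hE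
    (fun σ => orb (boxIx R 0) σ) ho' TX μ ν κhi hi κlo lo (gramTBRowsHalf K blocks) (gramTB K blocks) (lowerTB K blocks)
    (gramTBCoef_posSemidef K blocks) (gramTBOp (boxD R) blocks) (termOp_gramTB_eq_gramForm (boxD R) K blocks)
    (termOp_flatten_gramTBRowsHalf (boxD R) K blocks) EB CW hcw AV ns Hs segs hforest Cfin hfin hs hq

end ForestClosers

end CARPolyWindow

end Summit.Ventures.CertifiedManyBodySolver
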